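import Summits.CriticalPhenomena.CardyFormulaZ2.Theses.CardySelfRefinement
import HarnessLib

/-!
# The near-identity bootstrap on the lattice orbit
# (line `Sketch` of the crux `ScaleInvariantLimits`, stmt-CriticalPhenomena-10265)

Line `Sketch` (card "marginal-three-arm-bootstrap") of the crux `ScaleInvariantLimits` (every
subsequential scaling limit of the critical bond-`ℤ²` quad-crossing laws is dilation invariant)
reduces the crux to a *near-identity gain* C⁺: for a FIXED finite family of quads `G`, the joint
crossing probability `P(δ) := μ_δ {S | ∀ i, G i ∈ S}` (`μ_δ = squareCrossingLaw univ δ`) moves by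
at most `ε τ` between the meshes `δ` and `(1 + τ) δ`, for all small lags `τ` and all small meshes
`δ`.  On the lattice orbit the dilation acts by `S_t μ_δ = μ_{t δ}` (Schramm–Smirnov 2011, §1.4),
so C⁺ is a statement about the single real function `P`.

This file proves the **bootstrap** `stub_lags_of_nearIdentityGain`: C⁺ implies that for every
lag `k > 1` the joint crossing probabilities at meshes `k η` and `η` merge as `η → 0⁺`.  It is
pure real analysis (`tendsto_sub_of_nearIdentityGain`, for an arbitrary `f : ℝ → ℝ`): given `ε`,
choose `n ≥ 1` with `τ := k^{1/n} - 1 = exp (log k / n) - 1` below the threshold `τ₀` of C⁺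
(`exists_lag_pow_eq_of_one_lt`), so that `(1 + τ)^n = k` EXACTLY and `n τ ≤ k - 1` (Bernoulli);
for `η < δ₀ / k` telescope `f (k η) - f η` along the meshes `(1 + τ)^j η`, `j < n`, all below `δ₀`
(`abs_sub_le_of_lagSteps`): `|f (k η) - f η| ≤ n ε τ ≤ ε (k - 1)`.
-/

noncomputable section

open MeasureTheory Filter Set Topology
open Literature.Probability.Percolation Literature.Probability.Percolation.QuadCrossing

namespace Summit.CriticalPhenomena.CardyFormulaZ2.Theorems

/-- **Exact roots of a lag.**  For `k > 1` and a threshold `τ₀ > 0` there are `n ≥ 1` and a lag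
`0 < τ < τ₀` with `(1 + τ)^n = k` exactly and `n τ ≤ k - 1`: take `τ := exp (log k / n) - 1` for
`n` large (it tends to `0`), and compare with Bernoulli's `k ≤ (1 + (k - 1)/n)^n`. -/
theorem exists_lag_pow_eq_of_one_lt {k : ℝ} (hk : 1 < k) {τ₀ : ℝ} (hτ₀ : 0 < τ₀) :
    ∃ n : ℕ, ∃ τ : ℝ, 0 < τ ∧ τ < τ₀ ∧ (1 + τ) ^ n = k ∧ (n : ℝ) * τ ≤ k - 1 := by
  have hlogk : 0 < Real.log k := Real.log_pos hk
  have h0 : Tendsto (fun n : ℕ => Real.log k / n) atTop (𝓝 0) :=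
    tendsto_const_div_atTop_nhds_zero_nat (Real.log k)
  have h1 : Tendsto (fun n : ℕ => Real.exp (Real.log k / n) - 1) atTop (𝓝 0) := by
    have h := ((Real.continuous_exp.tendsto 0).comp h0).sub_const 1
    simpa using h
  obtain ⟨n, hn1, hnτ⟩ :=
    ((eventually_ge_atTop 1).and (h1.eventually (gt_mem_nhds hτ₀))).exists
  have hnpos : (0 : ℝ) < n := by exact_mod_cast hn1
  have hn0 : (n : ℝ) ≠ 0 := hnpos.ne'
  have hτpos : 0 < Real.exp (Real.log k / n) - 1 := by
    have h := Real.one_lt_exp_iff.mpr (div_pos hlogk hnpos)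
    linarith
  have hpow : (1 + (Real.exp (Real.log k / n) - 1)) ^ n = k := by
    rw [add_sub_cancel, ← Real.exp_nat_mul, mul_div_cancel₀ _ hn0, Real.exp_log (by linarith)]
  refine ⟨n, Real.exp (Real.log k / n) - 1, hτpos, hnτ, hpow, ?_⟩
  -- Bernoulli: `k = 1 + n ((k - 1)/n) ≤ (1 + (k - 1)/n)^n`, and `x ↦ x^n` is monotone.
  have hB : k ≤ (1 + (k - 1) / n) ^ n := by
    have hnn : 0 ≤ (k - 1) / n := by positivity
    have h := one_add_mul_le_pow (a := (k - 1) / n) (by linarith) n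
    rwa [mul_div_cancel₀ _ hn0, add_sub_cancel] at h
  have hle : 1 + (Real.exp (Real.log k / n) - 1) ≤ 1 + (k - 1) / n := by
    rw [← pow_le_pow_iff_left₀ (by linarith) (by positivity) (Nat.one_le_iff_ne_zero.mp hn1),
      hpow]
    exact hB
  have h := mul_le_mul_of_nonneg_left (by linarith : Real.exp (Real.log k / n) - 1 ≤ (k - 1) / n)
    hnpos.le
  rwa [mul_div_cancel₀ _ hn0] at h

/-- **Telescoping along a lattice of meshes.**  If each of the `n` steps
`(1 + τ)^j η ↦ (1 + τ)^(j+1) η`, `j < n`, moves `f` by at most `c`, then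
`|f ((1 + τ)^n η) - f η| ≤ n c`. -/
theorem abs_sub_le_of_lagSteps (f : ℝ → ℝ) {τ η c : ℝ} (n : ℕ)
    (hstep : ∀ j < n, |f ((1 + τ) * ((1 + τ) ^ j * η)) - f ((1 + τ) ^ j * η)| ≤ c) :
    |f ((1 + τ) ^ n * η) - f η| ≤ n * c := by
  have htel := Finset.sum_range_sub (fun j => f ((1 + τ) ^ j * η)) n
  simp only [pow_zero, one_mul] at htel
  rw [← htel]
  refine (Finset.abs_sum_le_sum_abs _ _).trans ?_
  have hle : ∀ j ∈ Finset.range n, |f ((1 + τ) ^ (j + 1) * η) - f ((1 + τ) ^ j * η)| ≤ c := by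
    intro j hj
    have h := hstep j (Finset.mem_range.mp hj)
    rwa [← mul_assoc, ← pow_succ'] at h
  refine (Finset.sum_le_card_nsmul _ _ _ hle).trans ?_
  rw [Finset.card_range, nsmul_eq_mul]

/-- **The near-identity bootstrap (real-variable form).**  If for every `ε > 0` there is a
threshold `τ₀ > 0` such that for every lag `0 < τ < τ₀` one has `|f ((1 + τ) δ) - f δ| ≤ ε τ` for
all small `δ > 0`, then `f (k η) - f η → 0` as `η → 0⁺`, for every `k > 1`.  Proof: with
`(1 + τ)^n = k`, `n τ ≤ k - 1` (`exists_lag_pow_eq_of_one_lt`) and `η < δ₀ / k`, telescope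
(`abs_sub_le_of_lagSteps`): `|f (k η) - f η| ≤ n ε τ ≤ ε (k - 1)`. -/
theorem tendsto_sub_of_nearIdentityGain (f : ℝ → ℝ)
    (hgain : ∀ ε : ℝ, 0 < ε → ∃ τ₀ : ℝ, 0 < τ₀ ∧ ∀ τ ∈ Ioo (0 : ℝ) τ₀, ∃ δ₀ : ℝ, 0 < δ₀ ∧
      ∀ δ ∈ Ioo (0 : ℝ) δ₀, |f ((1 + τ) * δ) - f δ| ≤ ε * τ)
    (k : ℝ) (hk : 1 < k) :
    Tendsto (fun η : ℝ => f (k * η) - f η) (𝓝[>] 0) (𝓝 0) := by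
  rw [Metric.tendsto_nhdsWithin_nhds]
  intro ε' hε'
  have hk1 : 0 < k - 1 := by linarith
  have hkpos : 0 < k := by linarith
  obtain ⟨τ₀, hτ₀, hτ⟩ := hgain (ε' / (2 * (k - 1))) (by positivity)
  obtain ⟨n, τ, hτpos, hτlt, hpow, hnτ⟩ := exists_lag_pow_eq_of_one_lt hk hτ₀
  obtain ⟨δ₀, hδ₀, hδ⟩ := hτ τ ⟨hτpos, hτlt⟩
  refine ⟨δ₀ / k, by positivity, fun η hη hdist => ?_⟩
  have hηpos : 0 < η := hη
  rw [Real.dist_eq, sub_zero, abs_of_pos hηpos, lt_div_iff₀ hkpos, mul_comm] at hdist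
  rw [Real.dist_eq, sub_zero]
  have hsteps : ∀ j < n,
      |f ((1 + τ) * ((1 + τ) ^ j * η)) - f ((1 + τ) ^ j * η)| ≤ ε' / (2 * (k - 1)) * τ := by
    intro j hj
    refine hδ _ ⟨by positivity, ?_⟩
    calc (1 + τ) ^ j * η ≤ (1 + τ) ^ n * η :=
          mul_le_mul_of_nonneg_right (pow_le_pow_right₀ (by linarith) hj.le) hηpos.le
      _ = k * η := by rw [hpow]
      _ < δ₀ := hdist
  have h := abs_sub_le_of_lagSteps f n hsteps
  rw [hpow] at h
  calc |f (k * η) - f η| ≤ n * (ε' / (2 * (k - 1)) * τ) := h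
    _ = ε' / (2 * (k - 1)) * (n * τ) := by ring
    _ ≤ ε' / (2 * (k - 1)) * (k - 1) := by gcongr
    _ = ε' / 2 := by
      field_simp
    _ < ε' := by linarith

/-- **STUB B of line `Sketch` — the near-identity bootstrap on the lattice orbit.**  If the
near-identity gain C⁺ holds (hypothesis `hgain`: for every finite family of quads `G` and every
`ε > 0`, the joint crossing probability of `G` under `squareCrossingLaw univ ·` changes by at
most `ε τ` between meshes `δ` and `(1 + τ) δ`, for all small lags `τ` and all small meshes `δ`),
then for every lag `k > 1` and every finite family `G` the joint crossing probabilities at meshes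
`k η` and `η` differ by `o(1)` as `η → 0⁺`.  This is `tendsto_sub_of_nearIdentityGain` applied to
`P(δ) := (squareCrossingLaw univ δ).real {S | ∀ i, G i ∈ S}`. -/
theorem stub_lags_of_nearIdentityGain
    (hgain : ∀ (m : ℕ) (G : Fin m → Quad (univ : Set ℂ)) (ε : ℝ), 0 < ε →
      ∃ τ₀ : ℝ, 0 < τ₀ ∧ ∀ τ ∈ Ioo (0 : ℝ) τ₀, ∃ δ₀ : ℝ, 0 < δ₀ ∧ ∀ δ ∈ Ioo (0 : ℝ) δ₀,
        |(squareCrossingLaw (univ : Set ℂ) ((1 + τ) * δ) :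
              Measure (QuadConfig (univ : Set ℂ))).real {S | ∀ i, G i ∈ S} -
          (squareCrossingLaw (univ : Set ℂ) δ : Measure (QuadConfig (univ : Set ℂ))).real
            {S | ∀ i, G i ∈ S}| ≤ ε * τ)
    (k : ℝ) (hk : 1 < k) (m : ℕ) (G : Fin m → Quad (univ : Set ℂ)) :
    Tendsto (fun η : ℝ =>
      (squareCrossingLaw (univ : Set ℂ) (k * η) : Measure (QuadConfig (univ : Set ℂ))).real
          {S | ∀ i, G i ∈ S} -
        (squareCrossingLaw (univ : Set ℂ) η : Measure (QuadConfig (univ : Set ℂ))).real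
          {S | ∀ i, G i ∈ S}) (𝓝[>] 0) (𝓝 0) :=
  tendsto_sub_of_nearIdentityGain
    (fun δ => (squareCrossingLaw (univ : Set ℂ) δ : Measure (QuadConfig (univ : Set ℂ))).real
      {S | ∀ i, G i ∈ S})
    (fun ε hε => hgain m G ε hε) k hk

end Summit.CriticalPhenomena.CardyFormulaZ2.Theorems

end
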